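import Summits.QuantumFields.QCD.Theses.SpectralDefectExtinction
import Literature.MathematicalPhysics.QuantumLattice.OverlapLocality
import Literature.Probability.LatticeModels.ThermodynamicLimit
import Literature.MathematicalPhysics.QuantumFieldTheory.QCD

/-!
# Flux-region coercivity (sub-goal `fluxRegion_hopping_form_le` of crux stmt-QuantumFields-8967)

Deterministic lemma (W) of the modular cell–wall template (crux idea `Cruxes/TipPricing/Ideas/modular-cell-wall-template.md`,
lead c2; serves stub `stub_spreadOfCells` of line `hermitian-flow-coarea` r3 for crux `TipPricing`, and is the REGION form of
8964-r3's `stub_fluxTemplateHalf`): on any set `S` of sites inside an embedded box whose INTERNAL links (both endpoints in `S`)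
carry the centre-flux pattern `U₁(y) = ω^{y₀}·1`, `U₃(y) = ω^{y₂}·1`, `U₀ = U₂ = 1` (`ω = e^{2πi/3}`, box coordinates `y`) up to
an entrywise error `η`, the covariant hopping form of every colour vector supported on `S` is bounded AWAY from its trivial
maximum `4‖φ‖²`:  `Σ_μ Re⟨φ, F_μ φ⟩ ≤ (4 − 3/8 + 12η)‖φ‖²` (`F_μ = linkHop`).  Consequently (not proved here)
`Re⟨ψ, (D_W(U) − δ)ψ⟩ ≥ (3/8 − δ − 12η)‖ψ‖²` for spinors supported on `S` (`wilsonDirac_eq_sub_sum_wilsonHop`), i.e. the wall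
block of `Γ₅(D_W − δ)` is coercive, invertible, and has inertia exactly half.  Proof route: group the directions into the planes
{0,1} and {2,3}; in each plane `2·Re⟨φ,(F_a + F_b)φ⟩ = ½ Σ_plaquettes (cycle form restricted to the links inside S)` (every torus
link lies in exactly two plaquettes of its plane); a FULL plaquette with holonomy `h` (`‖h − ω·1‖ ≤ 12η`) has cycle form
`≤ (2 − κ) Σ_{x∈p}‖φ_x‖²` with `κ = (√3 − 12η)₊²/16 ≥ 3/16 − 3η` by the telescoping bound
`‖(1 − h)φ₁‖ ≤ Σ_i ‖φ_i − u_i φ_{i+1}‖ ≤ 2 (Σ_i ‖φ_i − u_iφ_{i+1}‖²)^{1/2}` and `|1 − ω| = √3`, applied at each of the four corners;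
a PARTIAL plaquette (a path of ≤ 3 edges or a matching) has cycle form `≤ 2cos(π/5) Σ‖φ_x‖² < (2 − 3/16)Σ‖φ_x‖²` by weighted AM–GM
with golden-ratio weights; each site lies in 4 plaquettes of the plane.  Supports stmt-QuantumFields-8967 (helper; closes no item).
-/

noncomputable section

namespace Summit.QuantumFields.QCD.Cruxes.TipPricing.ModularTemplate

open Matrix
open Literature.MathematicalPhysics.QuantumLattice Literature.MathematicalPhysics.QuantumFieldTheory
  Literature.Probability.LatticeModels
open scoped BigOperators ComplexConjugate InnerProductSpace

/-- **Corner estimate** of the holonomy bound on a 4-cycle: transports `w_i` within `3η‖φ_{i+1}‖` of a scalar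
pattern `p_iφ_{i+1}` (`|p_i| ≤ 1`, `p₁p₂p₃p₄ = ω`, `|1 − ω|² = 3`) give `3‖φ₁‖² − 12η(Σ‖φ_j‖)‖φ₁‖ ≤ 4Σ‖φ_i − w_i‖²`
(telescoping `(1 − ω)φ₁ = Σ (p₁⋯p_{i−1})(φ_i − p_iφ_{i+1})`, triangle inequality, Cauchy–Schwarz). [folklore] -/
theorem fluxRegion_corner {E : Type*} [NormedAddCommGroup E] [InnerProductSpace ℂ E] (η : ℝ) (hη : 0 ≤ η)
    (ω : ℂ) (hω : ‖1 - ω‖ ^ 2 = 3) (φ₁ φ₂ φ₃ φ₄ w₁ w₂ w₃ w₄ : E) (p₁ p₂ p₃ p₄ : ℂ) (hp₁ : ‖p₁‖ ≤ 1)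
    (hp₂ : ‖p₂‖ ≤ 1) (hp₃ : ‖p₃‖ ≤ 1) (hprod : p₁ * p₂ * p₃ * p₄ = ω) (h₁ : ‖w₁ - p₁ • φ₂‖ ≤ 3 * η * ‖φ₂‖)
    (h₂ : ‖w₂ - p₂ • φ₃‖ ≤ 3 * η * ‖φ₃‖) (h₃ : ‖w₃ - p₃ • φ₄‖ ≤ 3 * η * ‖φ₄‖)
    (h₄ : ‖w₄ - p₄ • φ₁‖ ≤ 3 * η * ‖φ₁‖) :
    3 * ‖φ₁‖ ^ 2 - 12 * η * (‖φ₁‖ + ‖φ₂‖ + ‖φ₃‖ + ‖φ₄‖) * ‖φ₁‖ ≤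
      4 * (‖φ₁ - w₁‖ ^ 2 + ‖φ₂ - w₂‖ ^ 2 + ‖φ₃ - w₃‖ ^ 2 + ‖φ₄ - w₄‖ ^ 2) := by
  have key : (1 - ω) • φ₁ = (1 : ℂ) • (φ₁ - p₁ • φ₂) + p₁ • (φ₂ - p₂ • φ₃) + (p₁ * p₂) • (φ₃ - p₃ • φ₄) +
      (p₁ * p₂ * p₃) • (φ₄ - p₄ • φ₁) := by rw [← hprod]; module
  -- ‖(1-ω)φ₁‖ ≤ Σ ‖φ_i − p_iφ_{i+1}‖ ≤ Σ (‖φ_i − w_i‖ + 3η‖φ_{i+1}‖)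
  have hs : ‖(1 - ω) • φ₁‖ ≤ (‖φ₁ - w₁‖ + ‖φ₂ - w₂‖ + ‖φ₃ - w₃‖ + ‖φ₄ - w₄‖) +
      3 * η * (‖φ₁‖ + ‖φ₂‖ + ‖φ₃‖ + ‖φ₄‖) := by
    have e : ∀ (q : ℂ) (a w b : E) (r : ℝ), ‖q‖ ≤ 1 → ‖w - b‖ ≤ r → ‖q • (a - b)‖ ≤ ‖a - w‖ + r :=
      fun q a w b r hq h => by
        rw [norm_smul]
        exact (mul_le_of_le_one_left (norm_nonneg _) hq).trans
          ((norm_sub_le_norm_sub_add_norm_sub _ _ _).trans (by linarith))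
    have e₁ := e 1 φ₁ w₁ _ _ norm_one.le h₁
    have e₂ := e p₁ φ₂ w₂ _ _ hp₁ h₂
    have e₃ := e (p₁ * p₂) φ₃ w₃ _ _ (by rw [norm_mul]; exact mul_le_one₀ hp₁ (norm_nonneg _) hp₂) h₃
    have e₄ := e (p₁ * p₂ * p₃) φ₄ w₄ _ _ (by
      rw [norm_mul, norm_mul]; exact mul_le_one₀ (mul_le_one₀ hp₁ (norm_nonneg _) hp₂) (norm_nonneg _) hp₃) h₄
    have t1 := norm_add_le ((1 : ℂ) • (φ₁ - p₁ • φ₂) + p₁ • (φ₂ - p₂ • φ₃) + (p₁ * p₂) • (φ₃ - p₃ • φ₄))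
      ((p₁ * p₂ * p₃) • (φ₄ - p₄ • φ₁))
    have t2 := norm_add_le ((1 : ℂ) • (φ₁ - p₁ • φ₂) + p₁ • (φ₂ - p₂ • φ₃)) ((p₁ * p₂) • (φ₃ - p₃ • φ₄))
    have t3 := norm_add_le ((1 : ℂ) • (φ₁ - p₁ • φ₂)) (p₁ • (φ₂ - p₂ • φ₃))
    rw [key]; linarith
  set s := ‖(1 - ω) • φ₁‖ with hs_def
  set D := ‖φ₁ - w₁‖ + ‖φ₂ - w₂‖ + ‖φ₃ - w₃‖ + ‖φ₄ - w₄‖ with hD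
  set N := ‖φ₁‖ + ‖φ₂‖ + ‖φ₃‖ + ‖φ₄‖ with hN
  have hs2 : s ^ 2 = 3 * ‖φ₁‖ ^ 2 := by rw [hs_def, norm_smul, mul_pow, hω]
  have hsle : s ≤ 2 * ‖φ₁‖ := by
    rw [hs_def, norm_smul]
    exact mul_le_mul_of_nonneg_right (by nlinarith [norm_nonneg (1 - ω)]) (norm_nonneg _)
  have hs0 : 0 ≤ s := norm_nonneg _; have hηN : 0 ≤ η * N := mul_nonneg hη (by positivity)
  have hCS : D ^ 2 ≤ 4 * (‖φ₁ - w₁‖ ^ 2 + ‖φ₂ - w₂‖ ^ 2 + ‖φ₃ - w₃‖ ^ 2 + ‖φ₄ - w₄‖ ^ 2) := by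
    nlinarith [sq_nonneg (‖φ₁ - w₁‖ - ‖φ₂ - w₂‖), sq_nonneg (‖φ₁ - w₁‖ - ‖φ₃ - w₃‖),
      sq_nonneg (‖φ₁ - w₁‖ - ‖φ₄ - w₄‖), sq_nonneg (‖φ₂ - w₂‖ - ‖φ₃ - w₃‖),
      sq_nonneg (‖φ₂ - w₂‖ - ‖φ₄ - w₄‖), sq_nonneg (‖φ₃ - w₃‖ - ‖φ₄ - w₄‖)]
  have step1 : s ^ 2 - 6 * (η * N) * s ≤ D ^ 2 := by
    nlinarith [sq_nonneg (D - s), mul_nonneg hs0 (sub_nonneg.2 hs)]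
  have step2 : 3 * ‖φ₁‖ ^ 2 - 12 * η * N * ‖φ₁‖ ≤ s ^ 2 - 6 * (η * N) * s := by
    nlinarith [mul_le_mul_of_nonneg_left hsle hηN]
  linarith

/-- **Full plaquette**: norm-preserving transports `‖w_i‖ = ‖φ_{i+1}‖` near a scalar pattern of holonomy `ω`,
`|1 − ω|² = 3`, give `Σ Re⟨φ_i, w_i⟩ ≤ (29/32 + 3η)Σ‖φ_j‖²` (corner estimate at the four corners and
`Σ‖φ_i − w_i‖² = 2Σ‖φ_j‖² − 2Σ Re⟨φ_i, w_i⟩`). [folklore] -/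
theorem fluxRegion_full {E : Type*} [NormedAddCommGroup E] [InnerProductSpace ℂ E] (η : ℝ) (hη : 0 ≤ η)
    (ω : ℂ) (hω : ‖1 - ω‖ ^ 2 = 3) (φ₁ φ₂ φ₃ φ₄ w₁ w₂ w₃ w₄ : E) (p₁ p₂ p₃ p₄ : ℂ) (hp₁ : ‖p₁‖ ≤ 1)
    (hp₂ : ‖p₂‖ ≤ 1) (hp₃ : ‖p₃‖ ≤ 1) (hp₄ : ‖p₄‖ ≤ 1) (hprod : p₁ * p₂ * p₃ * p₄ = ω) (hw₁ : ‖w₁‖ = ‖φ₂‖)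
    (hw₂ : ‖w₂‖ = ‖φ₃‖) (hw₃ : ‖w₃‖ = ‖φ₄‖) (hw₄ : ‖w₄‖ = ‖φ₁‖) (h₁ : ‖w₁ - p₁ • φ₂‖ ≤ 3 * η * ‖φ₂‖)
    (h₂ : ‖w₂ - p₂ • φ₃‖ ≤ 3 * η * ‖φ₃‖) (h₃ : ‖w₃ - p₃ • φ₄‖ ≤ 3 * η * ‖φ₄‖)
    (h₄ : ‖w₄ - p₄ • φ₁‖ ≤ 3 * η * ‖φ₁‖) :
    RCLike.re ⟪φ₁, w₁⟫_ℂ + RCLike.re ⟪φ₂, w₂⟫_ℂ + RCLike.re ⟪φ₃, w₃⟫_ℂ + RCLike.re ⟪φ₄, w₄⟫_ℂ ≤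
      (29 / 32 + 3 * η) * (‖φ₁‖ ^ 2 + ‖φ₂‖ ^ 2 + ‖φ₃‖ ^ 2 + ‖φ₄‖ ^ 2) := by
  have c1 := fluxRegion_corner η hη ω hω φ₁ φ₂ φ₃ φ₄ w₁ w₂ w₃ w₄ p₁ p₂ p₃ p₄ hp₁ hp₂ hp₃ hprod h₁ h₂ h₃ h₄
  have c2 := fluxRegion_corner η hη ω hω φ₂ φ₃ φ₄ φ₁ w₂ w₃ w₄ w₁ p₂ p₃ p₄ p₁ hp₂ hp₃ hp₄
    (by rw [← hprod]; ring) h₂ h₃ h₄ h₁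
  have c3 := fluxRegion_corner η hη ω hω φ₃ φ₄ φ₁ φ₂ w₃ w₄ w₁ w₂ p₃ p₄ p₁ p₂ hp₃ hp₄ hp₁
    (by rw [← hprod]; ring) h₃ h₄ h₁ h₂
  have c4 := fluxRegion_corner η hη ω hω φ₄ φ₁ φ₂ φ₃ w₄ w₁ w₂ w₃ p₄ p₁ p₂ p₃ hp₄ hp₁ hp₂
    (by rw [← hprod]; ring) h₄ h₁ h₂ h₃
  have d1 := @norm_sub_sq ℂ _ _ _ _ φ₁ w₁; rw [hw₁] at d1
  have d2 := @norm_sub_sq ℂ _ _ _ _ φ₂ w₂; rw [hw₂] at d2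
  have d3 := @norm_sub_sq ℂ _ _ _ _ φ₃ w₃; rw [hw₃] at d3
  have d4 := @norm_sub_sq ℂ _ _ _ _ φ₄ w₄; rw [hw₄] at d4
  have hN : (‖φ₁‖ + ‖φ₂‖ + ‖φ₃‖ + ‖φ₄‖) ^ 2 ≤ 4 * (‖φ₁‖ ^ 2 + ‖φ₂‖ ^ 2 + ‖φ₃‖ ^ 2 + ‖φ₄‖ ^ 2) := by
    nlinarith [sq_nonneg (‖φ₁‖ - ‖φ₂‖), sq_nonneg (‖φ₁‖ - ‖φ₃‖), sq_nonneg (‖φ₁‖ - ‖φ₄‖),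
      sq_nonneg (‖φ₂‖ - ‖φ₃‖), sq_nonneg (‖φ₂‖ - ‖φ₄‖), sq_nonneg (‖φ₃‖ - ‖φ₄‖)]
  have hQ : 0 ≤ ‖φ₁‖ ^ 2 + ‖φ₂‖ ^ 2 + ‖φ₃‖ ^ 2 + ‖φ₄‖ ^ 2 := by positivity
  linarith [mul_le_mul_of_nonneg_left hN hη, mul_nonneg hη hQ]

/-- **Partial plaquette**: if one corner vector vanishes the cycle form is a path form, and
`Σ Re⟨φ_i, w_i⟩ ≤ (29/32)Σ‖φ_j‖²` (Cauchy–Schwarz and weighted AM–GM; sharp constant `cos(π/4)`). [folklore] -/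
theorem fluxRegion_partial {E : Type*} [NormedAddCommGroup E] [InnerProductSpace ℂ E]
    (φ₁ φ₂ φ₃ φ₄ w₁ w₂ w₃ w₄ : E) (hw₁ : ‖w₁‖ = ‖φ₂‖) (hw₂ : ‖w₂‖ = ‖φ₃‖) (hw₃ : ‖w₃‖ = ‖φ₄‖)
    (hw₄ : ‖w₄‖ = ‖φ₁‖) (h0 : φ₁ = 0 ∨ φ₂ = 0 ∨ φ₃ = 0 ∨ φ₄ = 0) :
    RCLike.re ⟪φ₁, w₁⟫_ℂ + RCLike.re ⟪φ₂, w₂⟫_ℂ + RCLike.re ⟪φ₃, w₃⟫_ℂ + RCLike.re ⟪φ₄, w₄⟫_ℂ ≤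
      29 / 32 * (‖φ₁‖ ^ 2 + ‖φ₂‖ ^ 2 + ‖φ₃‖ ^ 2 + ‖φ₄‖ ^ 2) := by
  have b1 : RCLike.re ⟪φ₁, w₁⟫_ℂ ≤ ‖φ₁‖ * ‖φ₂‖ := hw₁ ▸ re_inner_le_norm φ₁ w₁
  have b2 : RCLike.re ⟪φ₂, w₂⟫_ℂ ≤ ‖φ₂‖ * ‖φ₃‖ := hw₂ ▸ re_inner_le_norm φ₂ w₂
  have b3 : RCLike.re ⟪φ₃, w₃⟫_ℂ ≤ ‖φ₃‖ * ‖φ₄‖ := hw₃ ▸ re_inner_le_norm φ₃ w₃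
  have b4 : RCLike.re ⟪φ₄, w₄⟫_ℂ ≤ ‖φ₄‖ * ‖φ₁‖ := hw₄ ▸ re_inner_le_norm φ₄ w₄
  have r1 := norm_nonneg φ₁; have r2 := norm_nonneg φ₂; have r3 := norm_nonneg φ₃; have r4 := norm_nonneg φ₄
  rcases h0 with h | h | h | h <;> simp only [h, norm_zero, zero_mul, mul_zero] at b1 b2 b3 b4 ⊢
  · nlinarith [mul_self_nonneg (29 * ‖φ₂‖ - 16 * ‖φ₃‖), mul_self_nonneg (29 * ‖φ₄‖ - 16 * ‖φ₃‖)]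
  · nlinarith [mul_self_nonneg (29 * ‖φ₃‖ - 16 * ‖φ₄‖), mul_self_nonneg (29 * ‖φ₁‖ - 16 * ‖φ₄‖)]
  · nlinarith [mul_self_nonneg (29 * ‖φ₄‖ - 16 * ‖φ₁‖), mul_self_nonneg (29 * ‖φ₂‖ - 16 * ‖φ₁‖)]
  · nlinarith [mul_self_nonneg (29 * ‖φ₁‖ - 16 * ‖φ₂‖), mul_self_nonneg (29 * ‖φ₃‖ - 16 * ‖φ₂‖)]

/-- A matrix with `uᴴu = 1` preserves the Euclidean norm on `EuclideanSpace ℂ (Fin 3)`. [folklore] -/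
theorem fluxRegion_norm_toLp_mulVec (u : Matrix (Fin 3) (Fin 3) ℂ) (hu : uᴴ * u = 1) (f : Fin 3 → ℂ) :
    ‖(WithLp.toLp 2 (u *ᵥ f) : EuclideanSpace ℂ (Fin 3))‖ = ‖(WithLp.toLp 2 f : EuclideanSpace ℂ (Fin 3))‖ := by
  have key : ∀ g : Fin 3 → ℂ,
      ‖(WithLp.toLp 2 g : EuclideanSpace ℂ (Fin 3))‖ ^ 2 = RCLike.re (star g ⬝ᵥ g) := fun g => by
    rw [← @inner_self_eq_norm_sq ℂ, EuclideanSpace.inner_toLp_toLp, dotProduct_comm]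
  have h1 : star (u *ᵥ f) ⬝ᵥ (u *ᵥ f) = star f ⬝ᵥ f := by
    rw [Matrix.star_mulVec, ← dotProduct_mulVec, Matrix.mulVec_mulVec, hu, Matrix.one_mulVec]
  have h2 := key (u *ᵥ f)
  rw [h1, ← key f] at h2
  exact (sq_eq_sq₀ (norm_nonneg _) (norm_nonneg _)).mp h2

/-- Entrywise closeness `|u_{ij} − pδ_{ij}| ≤ η` gives `‖uf − pf‖ ≤ 3η‖f‖` on `ℂ³` (Cauchy–Schwarz). [folklore] -/
theorem fluxRegion_norm_toLp_sub_le (η : ℝ) (hη : 0 ≤ η) (u : Matrix (Fin 3) (Fin 3) ℂ) (p : ℂ)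
    (h : ∀ i j, ‖u i j - (if i = j then p else 0)‖ ≤ η) (f : Fin 3 → ℂ) :
    ‖(WithLp.toLp 2 (u *ᵥ f) : EuclideanSpace ℂ (Fin 3)) - p • (WithLp.toLp 2 f : EuclideanSpace ℂ (Fin 3))‖ ≤
      3 * η * ‖(WithLp.toLp 2 f : EuclideanSpace ℂ (Fin 3))‖ := by
  have hf0 := norm_nonneg (WithLp.toLp 2 f : EuclideanSpace ℂ (Fin 3))
  rw [← WithLp.toLp_smul, ← WithLp.toLp_sub]
  refine le_of_sq_le_sq ?_ (by positivity)
  rw [EuclideanSpace.norm_sq_eq, mul_pow, EuclideanSpace.norm_sq_eq]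
  simp only [Pi.sub_apply, Pi.smul_apply, smul_eq_mul]
  have h3 : (∑ b, ‖f b‖) ^ 2 ≤ 3 * ∑ b, ‖f b‖ ^ 2 := by
    simpa using sq_sum_le_card_mul_sum_sq (s := (Finset.univ : Finset (Fin 3))) (f := fun b => ‖f b‖)
  have hsq : ∀ a : Fin 3, ‖(u *ᵥ f) a - p * f a‖ ^ 2 ≤ η ^ 2 * (3 * ∑ b, ‖f b‖ ^ 2) := by
    intro a
    have hcomp : ‖(u *ᵥ f) a - p * f a‖ ≤ η * ∑ b, ‖f b‖ := by
      have e : (u *ᵥ f) a - p * f a = ∑ b, (u a b - if a = b then p else 0) * f b := by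
        simp only [Matrix.mulVec, dotProduct, sub_mul, Finset.sum_sub_distrib, ite_mul, zero_mul,
          Finset.sum_ite_eq, Finset.mem_univ, if_true]
      rw [e, Finset.mul_sum]
      refine (norm_sum_le _ _).trans (Finset.sum_le_sum fun b _ => ?_)
      rw [norm_mul]
      exact mul_le_mul_of_nonneg_right (h a b) (norm_nonneg _)
    calc ‖(u *ᵥ f) a - p * f a‖ ^ 2 ≤ (η * ∑ b, ‖f b‖) ^ 2 := pow_le_pow_left₀ (norm_nonneg _) hcomp 2
      _ = η ^ 2 * (∑ b, ‖f b‖) ^ 2 := by ring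
      _ ≤ η ^ 2 * (3 * ∑ b, ‖f b‖ ^ 2) := mul_le_mul_of_nonneg_left h3 (sq_nonneg _)
  calc ∑ a, ‖(u *ᵥ f) a - p * f a‖ ^ 2 ≤ ∑ _a : Fin 3, η ^ 2 * (3 * ∑ b, ‖f b‖ ^ 2) :=
        Finset.sum_le_sum fun a _ => hsq a
    _ = _ := by simp; ring

/-- `Re⟨g, uᴴ f⟩ = Re⟨f, u g⟩`. [folklore] -/
theorem fluxRegion_re_conjTranspose (u : Matrix (Fin 3) (Fin 3) ℂ) (f g : Fin 3 → ℂ) :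
    (star g ⬝ᵥ uᴴ *ᵥ f).re = (star f ⬝ᵥ u *ᵥ g).re := by
  conv_rhs => rw [Matrix.star_dotProduct, Matrix.star_mulVec, ← dotProduct_mulVec]
  exact (Complex.conj_re _).symm

/-- The real part of the `EuclideanSpace` inner product of `toLp f`, `toLp g` is `Re (f† g)`. [folklore] -/
theorem fluxRegion_re_inner_toLp (f g : Fin 3 → ℂ) :
    RCLike.re ⟪(WithLp.toLp 2 f : EuclideanSpace ℂ (Fin 3)), (WithLp.toLp 2 g : EuclideanSpace ℂ (Fin 3))⟫_ℂ =
      (star f ⬝ᵥ g).re := by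
  rw [EuclideanSpace.inner_toLp_toLp, dotProduct_comm]; rfl

/-- `‖toLp f‖² = Σ_i |f_i|²`. [folklore] -/
theorem fluxRegion_norm_sq_toLp (f : Fin 3 → ℂ) :
    ‖(WithLp.toLp 2 f : EuclideanSpace ℂ (Fin 3))‖ ^ 2 = ∑ i, ‖f i‖ ^ 2 := by
  rw [EuclideanSpace.norm_sq_eq]

/-- `|1 − ω|² = 3` for `ω = e^{2πi/3}` (`cos(2π/3) = −1/2`, `sin²(2π/3) = 3/4`). [folklore] -/
theorem fluxRegion_omega : ‖1 - Complex.exp (2 * Real.pi * Complex.I / 3)‖ ^ 2 = 3 := by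
  have e : (2 * Real.pi * Complex.I / 3 : ℂ) = ((2 * (Real.pi / 3) : ℝ) : ℂ) * Complex.I := by push_cast; ring
  have hre : (Complex.exp (2 * Real.pi * Complex.I / 3)).re = -1 / 2 := by
    rw [e, Complex.exp_ofReal_mul_I_re, Real.cos_two_mul, Real.cos_pi_div_three]; norm_num
  have him : (Complex.exp (2 * Real.pi * Complex.I / 3)).im ^ 2 = 3 / 4 := by
    have h1 := Real.sin_sq_add_cos_sq (2 * (Real.pi / 3))
    rw [Real.cos_two_mul, Real.cos_pi_div_three] at h1
    rw [e, Complex.exp_ofReal_mul_I_im]; linarith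
  rw [Complex.sq_norm, Complex.normSq_apply, Complex.sub_re, Complex.sub_im, Complex.one_re, Complex.one_im, hre]
  nlinarith [him]

/-- `|e^{2πik/3}| = 1`. [folklore] -/
theorem fluxRegion_norm_cexp (k : ℤ) : ‖Complex.exp (2 * Real.pi * Complex.I * (k : ℂ) / 3)‖ = 1 := by
  have e : (2 * Real.pi * Complex.I * (k : ℂ) / 3 : ℂ) = ((2 * Real.pi * k / 3 : ℝ) : ℂ) * Complex.I := by
    push_cast; ring
  rw [e, Complex.norm_exp_ofReal_mul_I]

/-- Entrywise closeness to `p·1` passes to the conjugate transpose (pattern `p̄·1`). [folklore] -/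
theorem fluxRegion_conjTranspose_entry (η : ℝ) (u : Matrix (Fin 3) (Fin 3) ℂ) (p : ℂ)
    (h : ∀ i j, ‖u i j - (if i = j then p else 0)‖ ≤ η) (i j : Fin 3) :
    ‖uᴴ i j - (if i = j then conj p else 0)‖ ≤ η := by
  rw [Matrix.conjTranspose_apply]
  have hji := h j i
  by_cases hij : i = j
  · subst hij
    rw [if_pos rfl] at hji ⊢
    rw [← norm_star, star_sub, star_star]
    simpa using hji
  · rw [if_neg hij, sub_zero, norm_star]
    rw [if_neg (Ne.symm hij), sub_zero] at hji
    exact hji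

/-- **Per-plaquette bound** (matrix form): for `u_iᴴu_i = 1` and corners `f_i ∈ ℂ³`, if some corner vanishes or the
four links are entrywise within `η` of a scalar pattern with holonomy `e^{2πi/3}`, then
`Σ Re(f_i† u_i f_{i+1}) ≤ (29/32 + 3η)Σ‖f_j‖²`. [folklore] -/
theorem fluxRegion_plaquette (η : ℝ) (hη : 0 ≤ η) (f₁ f₂ f₃ f₄ : Fin 3 → ℂ) (u₁ u₂ u₃ u₄ : Matrix (Fin 3) (Fin 3) ℂ)
    (hu₁ : u₁ᴴ * u₁ = 1) (hu₂ : u₂ᴴ * u₂ = 1) (hu₃ : u₃ᴴ * u₃ = 1) (hu₄ : u₄ᴴ * u₄ = 1)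
    (h : (f₁ = 0 ∨ f₂ = 0 ∨ f₃ = 0 ∨ f₄ = 0) ∨
      ∃ p₁ p₂ p₃ p₄ : ℂ, ‖p₁‖ ≤ 1 ∧ ‖p₂‖ ≤ 1 ∧ ‖p₃‖ ≤ 1 ∧ ‖p₄‖ ≤ 1 ∧
        p₁ * p₂ * p₃ * p₄ = Complex.exp (2 * Real.pi * Complex.I / 3) ∧
        (∀ i j, ‖u₁ i j - (if i = j then p₁ else 0)‖ ≤ η) ∧ (∀ i j, ‖u₂ i j - (if i = j then p₂ else 0)‖ ≤ η) ∧
        (∀ i j, ‖u₃ i j - (if i = j then p₃ else 0)‖ ≤ η) ∧ (∀ i j, ‖u₄ i j - (if i = j then p₄ else 0)‖ ≤ η)) :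
    (star f₁ ⬝ᵥ u₁ *ᵥ f₂).re + (star f₂ ⬝ᵥ u₂ *ᵥ f₃).re + (star f₃ ⬝ᵥ u₃ *ᵥ f₄).re + (star f₄ ⬝ᵥ u₄ *ᵥ f₁).re ≤
      (29 / 32 + 3 * η) * (∑ i, ‖f₁ i‖ ^ 2 + ∑ i, ‖f₂ i‖ ^ 2 + ∑ i, ‖f₃ i‖ ^ 2 + ∑ i, ‖f₄ i‖ ^ 2) := by
  rw [← fluxRegion_re_inner_toLp f₁, ← fluxRegion_re_inner_toLp f₂, ← fluxRegion_re_inner_toLp f₃,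
    ← fluxRegion_re_inner_toLp f₄, ← fluxRegion_norm_sq_toLp f₁, ← fluxRegion_norm_sq_toLp f₂,
    ← fluxRegion_norm_sq_toLp f₃, ← fluxRegion_norm_sq_toLp f₄]
  have hw₁ := fluxRegion_norm_toLp_mulVec u₁ hu₁ f₂; have hw₂ := fluxRegion_norm_toLp_mulVec u₂ hu₂ f₃
  have hw₃ := fluxRegion_norm_toLp_mulVec u₃ hu₃ f₄; have hw₄ := fluxRegion_norm_toLp_mulVec u₄ hu₄ f₁
  rcases h with h0 | ⟨p₁, p₂, p₃, p₄, hp₁, hp₂, hp₃, hp₄, hprod, e₁, e₂, e₃, e₄⟩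
  · refine (fluxRegion_partial _ _ _ _ _ _ _ _ hw₁ hw₂ hw₃ hw₄ ?_).trans ?_
    · rcases h0 with h | h | h | h <;> simp [h]
    · nlinarith [mul_nonneg hη (by positivity : (0 : ℝ) ≤ ‖(WithLp.toLp 2 f₁ : EuclideanSpace ℂ (Fin 3))‖ ^ 2 +
        ‖(WithLp.toLp 2 f₂ : EuclideanSpace ℂ (Fin 3))‖ ^ 2 + ‖(WithLp.toLp 2 f₃ : EuclideanSpace ℂ (Fin 3))‖ ^ 2 +
        ‖(WithLp.toLp 2 f₄ : EuclideanSpace ℂ (Fin 3))‖ ^ 2)]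
  · exact fluxRegion_full η hη _ fluxRegion_omega _ _ _ _ _ _ _ _ p₁ p₂ p₃ p₄ hp₁ hp₂ hp₃ hp₄ hprod hw₁ hw₂ hw₃
      hw₄ (fluxRegion_norm_toLp_sub_le η hη u₁ p₁ e₁ f₂) (fluxRegion_norm_toLp_sub_le η hη u₂ p₂ e₂ f₃)
      (fluxRegion_norm_toLp_sub_le η hη u₃ p₃ e₃ f₄) (fluxRegion_norm_toLp_sub_le η hη u₄ p₄ e₄ f₁)

/-- The covariant hopping form site by site: `φ† F_μ φ = Σ_x φ_x† U(x,μ) φ_{x+μ̂}`. [folklore] -/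
theorem fluxRegion_form_eq {n : ℕ} [NeZero n] (U : GaugeConfig 4 n SU3) (μ : Fin 4) (φ : TorusSite 4 n × Fin 3 → ℂ) :
    (star φ ⬝ᵥ linkHop (fundamentalRep (Fin 3)) U μ *ᵥ φ).re = ∑ x : TorusSite 4 n, (star (fun i => φ (x, i)) ⬝ᵥ
      (U (x, μ) : Matrix (Fin 3) (Fin 3) ℂ) *ᵥ fun i => φ (x + Pi.single μ 1, i)).re := by
  rw [← Complex.re_sum]
  congr 1
  simp only [dotProduct, Matrix.mulVec, linkHop, Matrix.of_apply, Fintype.sum_prod_type, Pi.star_apply, ite_mul,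
    zero_mul, Finset.sum_ite_irrel, Finset.sum_const_zero, Finset.sum_ite_eq', Finset.mem_univ, if_true,
    fundamentalRep_apply, Literature.MathematicalPhysics.QuantumFieldTheory.Site.shift]

/-- `Torus.proj` commutes with a unit lattice step. [folklore] -/
theorem fluxRegion_proj_add_single {n : ℕ} (z : Fin 4 → ℤ) (a : Fin 4) :
    Torus.proj n (z + Pi.single a 1) = Torus.proj n z + Pi.single a 1 := by
  funext i
  simp only [Torus.proj_apply, Pi.add_apply, Pi.single_apply, Int.cast_add]
  split_ifs <;> simp

/-- Box coordinates of a neighbour: for `y, y' ∈ {−R..R}⁴`, `2R+1 < n`, `proj(c+y') = proj(c+y) + â` on the torus of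
side `n` forces `y' = y + â` (each coordinate of `y' − y − â` is a multiple of `n` of modulus `< n`). [folklore] -/
theorem fluxRegion_box_step {n : ℕ} (c : Fin 4 → ℤ) (R : ℕ) (hR : 2 * R + 1 < n) {y y' : Fin 4 → ℤ}
    (hy : y ∈ box 4 R) (hy' : y' ∈ box 4 R) (a : Fin 4)
    (h : Torus.proj n (c + y') = Torus.proj n (c + y) + Pi.single a 1) : y' = y + Pi.single a 1 := by
  funext i
  have hi := congr_fun h i
  have hyi := (mem_box.mp hy) i; have hy'i := (mem_box.mp hy') i
  simp only [Torus.proj_apply, Pi.add_apply, Int.cast_add, Pi.single_apply] at hi ⊢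
  have key : ∀ t : ℤ, ((y' i : ℤ) : ZMod n) = ((y i + t : ℤ) : ZMod n) → -(n : ℤ) < y i + t - y' i →
      y i + t - y' i < n → y' i = y i + t := fun t e h1 h2 => by
    rw [ZMod.intCast_eq_intCast_iff_dvd_sub] at e
    have := Int.eq_zero_of_abs_lt_dvd e (abs_lt.mpr ⟨h1, h2⟩)
    omega
  split_ifs at hi ⊢
  · exact key 1 (by push_cast; linear_combination hi) (by omega) (by omega)
  · simpa using key 0 (by push_cast; linear_combination hi) (by omega) (by omega)

/-- **One coordinate plane.**  If the internal links of `S` in direction `a` are entrywise within `η` of `1` and those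
in direction `b` within `η` of `ω^{y_a}·1` (`ω = e^{2πi/3}`, `y_a` the box coordinate of the base point), then for `φ`
supported on `S`, `Re⟨φ, F_aφ⟩ + Re⟨φ, F_bφ⟩ ≤ (29/16 + 6η)‖φ‖²`: every link lies in two plaquettes of the plane, so
twice the left side is the sum over base points `x` of the cycle forms of `P(x)` (backward links through
`Re⟨g, Uᴴf⟩ = Re⟨f, Ug⟩`), each bounded by `fluxRegion_plaquette` (a full plaquette has pattern holonomy
`1·ω^{y_a+1}·1·ω^{−y_a} = ω`, neighbours' box coordinates `y + â`, `y + b̂` by `fluxRegion_box_step`), and every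
site is a corner of four plaquettes. [folklore] -/
theorem fluxRegion_plane {n : ℕ} [NeZero n] (U : GaugeConfig 4 n SU3) (c : Fin 4 → ℤ) (R : ℕ) (hR : 2 * R + 1 < n)
    (S : Set (TorusSite 4 n)) (η : ℝ) (hη : 0 ≤ η)
    (hS : ∀ x ∈ S, ∃ y : Fin 4 → ℤ, y ∈ box 4 R ∧ Torus.proj n (c + y) = x) (a b : Fin 4)
    (ha : ∀ y : Fin 4 → ℤ, y ∈ box 4 R → Torus.proj n (c + y) ∈ S → Torus.proj n (c + y + Pi.single a 1) ∈ S →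
      ∀ i j : Fin 3, ‖(↑(U (Torus.proj n (c + y), a)) : Matrix (Fin 3) (Fin 3) ℂ) i j - (if i = j then 1 else 0)‖ ≤ η)
    (hb : ∀ y : Fin 4 → ℤ, y ∈ box 4 R → Torus.proj n (c + y) ∈ S → Torus.proj n (c + y + Pi.single b 1) ∈ S →
      ∀ i j : Fin 3, ‖(↑(U (Torus.proj n (c + y), b)) : Matrix (Fin 3) (Fin 3) ℂ) i j -
        (if i = j then Complex.exp (2 * Real.pi * Complex.I * ((y a : ℤ) : ℂ) / 3) else 0)‖ ≤ η)
    (φ : TorusSite 4 n × Fin 3 → ℂ) (hφ : ∀ p : TorusSite 4 n × Fin 3, p.1 ∉ S → φ p = 0) :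
    (∑ x : TorusSite 4 n, (star (fun i => φ (x, i)) ⬝ᵥ
        (U (x, a) : Matrix (Fin 3) (Fin 3) ℂ) *ᵥ fun i => φ (x + Pi.single a 1, i)).re) +
      (∑ x : TorusSite 4 n, (star (fun i => φ (x, i)) ⬝ᵥ
        (U (x, b) : Matrix (Fin 3) (Fin 3) ℂ) *ᵥ fun i => φ (x + Pi.single b 1, i)).re) ≤
      (29 / 16 + 6 * η) * ∑ p, ‖φ p‖ ^ 2 := by
  obtain ⟨T, hT⟩ : ∃ T : TorusSite 4 n → Fin 4 → ℝ, ∀ x μ, T x μ = (star (fun i => φ (x, i)) ⬝ᵥ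
      (U (x, μ) : Matrix (Fin 3) (Fin 3) ℂ) *ᵥ fun i => φ (x + Pi.single μ 1, i)).re := ⟨_, fun _ _ => rfl⟩
  obtain ⟨Nm, hNm⟩ : ∃ Nm : TorusSite 4 n → ℝ, ∀ x, Nm x = ∑ i, ‖φ (x, i)‖ ^ 2 := ⟨_, fun _ => rfl⟩
  have hQ : ∑ p, ‖φ p‖ ^ 2 = ∑ x, Nm x := by simp only [hNm]; exact Fintype.sum_prod_type _
  simp only [← hT]
  rw [hQ]
  have hun : ∀ g : SU3, (g : Matrix (Fin 3) (Fin 3) ℂ)ᴴ * (g : Matrix (Fin 3) (Fin 3) ℂ) = 1 := fun g =>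
    Matrix.mem_unitaryGroup_iff'.mp (fundamentalRep_mem_unitaryGroup g)
  have hun' : ∀ g : SU3, ((g : Matrix (Fin 3) (Fin 3) ℂ)ᴴ)ᴴ * (g : Matrix (Fin 3) (Fin 3) ℂ)ᴴ = 1 := fun g => by
    rw [Matrix.conjTranspose_conjTranspose]; exact Matrix.mem_unitaryGroup_iff.mp (fundamentalRep_mem_unitaryGroup g)
  -- the cycle form of the plaquette based at `x`
  have hplaq : ∀ x : TorusSite 4 n, T x a + T (x + Pi.single a 1) b + T (x + Pi.single b 1) a + T x b ≤
      (29 / 32 + 3 * η) *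
        (Nm x + Nm (x + Pi.single a 1) + Nm (x + Pi.single a 1 + Pi.single b 1) + Nm (x + Pi.single b 1)) := by
    intro x
    have e3 : T (x + Pi.single b 1) a = (star (fun i => φ (x + Pi.single a 1 + Pi.single b 1, i)) ⬝ᵥ
        ((U (x + Pi.single b 1, a) : Matrix (Fin 3) (Fin 3) ℂ))ᴴ *ᵥ fun i => φ (x + Pi.single b 1, i)).re := by
      rw [hT, fluxRegion_re_conjTranspose, add_right_comm]
    have e4 : T x b = (star (fun i => φ (x + Pi.single b 1, i)) ⬝ᵥ
        ((U (x, b) : Matrix (Fin 3) (Fin 3) ℂ))ᴴ *ᵥ fun i => φ (x, i)).re := by rw [hT, fluxRegion_re_conjTranspose]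
    rw [e3, e4, hT, hT, hNm, hNm, hNm, hNm]
    refine fluxRegion_plaquette η hη _ _ _ _ _ _ _ _ (hun _) (hun _) (hun' _) (hun' _) ?_
    by_cases hall : x ∈ S ∧ x + Pi.single a 1 ∈ S ∧ x + Pi.single a 1 + Pi.single b 1 ∈ S ∧ x + Pi.single b 1 ∈ S
    · right
      obtain ⟨h1, h2, h3, h4⟩ := hall
      obtain ⟨y, hy, rfl⟩ := hS _ h1
      have hya : y + Pi.single a 1 ∈ box 4 R := by
        obtain ⟨y', hy', e⟩ := hS _ h2; obtain rfl := fluxRegion_box_step c R hR hy hy' a e; exact hy'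
      have hyb : y + Pi.single b 1 ∈ box 4 R := by
        obtain ⟨y', hy', e⟩ := hS _ h4; obtain rfl := fluxRegion_box_step c R hR hy hy' b e; exact hy'
      have q₁ := ha y hy h1 (by rwa [fluxRegion_proj_add_single])
      have q₂ := hb (y + Pi.single a 1) hya (by rwa [← add_assoc, fluxRegion_proj_add_single])
        (by rw [← add_assoc, fluxRegion_proj_add_single, fluxRegion_proj_add_single]; exact h3)
      have q₃ := ha (y + Pi.single b 1) hyb (by rwa [← add_assoc, fluxRegion_proj_add_single])
        (by rw [← add_assoc, fluxRegion_proj_add_single, fluxRegion_proj_add_single, add_right_comm]; exact h3)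
      have q₄ := hb y hy h1 (by rwa [fluxRegion_proj_add_single])
      simp only [← add_assoc, fluxRegion_proj_add_single, Pi.add_apply, Pi.single_eq_same] at q₂ q₃
      refine ⟨1, Complex.exp (2 * Real.pi * Complex.I * ((y a + 1 : ℤ) : ℂ) / 3), conj 1,
        conj (Complex.exp (2 * Real.pi * Complex.I * ((y a : ℤ) : ℂ) / 3)), norm_one.le, (fluxRegion_norm_cexp _).le,
        by rw [map_one, norm_one], by rw [Complex.norm_conj]; exact (fluxRegion_norm_cexp _).le, ?_, q₁, q₂,
        fluxRegion_conjTranspose_entry η _ _ q₃, fluxRegion_conjTranspose_entry η _ _ q₄⟩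
      rw [map_one, one_mul, mul_one, ← Complex.exp_conj, ← Complex.exp_add]
      congr 1
      simp only [map_div₀, map_mul, Complex.conj_ofReal, Complex.conj_I, map_intCast, map_ofNat]
      push_cast
      ring
    · left
      have hz : ∀ z : TorusSite 4 n, z ∉ S → (fun i => φ (z, i)) = 0 := fun z h => funext fun i => hφ (z, i) h
      simp only [not_and_or] at hall
      rcases hall with h | h | h | h
      exacts [Or.inl (hz _ h), Or.inr (Or.inl (hz _ h)), Or.inr (Or.inr (Or.inl (hz _ h))), Or.inr (Or.inr (Or.inr (hz _ h)))]
  -- sum over base points; every link is counted twice, every site four times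
  have hsum := Finset.sum_le_sum fun x (_ : x ∈ Finset.univ) => hplaq x
  simp only [Finset.sum_add_distrib, ← Finset.mul_sum] at hsum
  have hs : ∀ (F : TorusSite 4 n → ℝ) (v : TorusSite 4 n), ∑ x, F (x + v) = ∑ x, F x := fun F v =>
    Fintype.sum_equiv (Equiv.addRight v) _ _ fun _ => rfl
  have s1 : ∑ x, T (x + Pi.single a 1) b = ∑ x, T x b := hs (fun x => T x b) (Pi.single a 1)
  have s2 : ∑ x, T (x + Pi.single b 1) a = ∑ x, T x a := hs (fun x => T x a) (Pi.single b 1)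
  have s3 : ∑ x, Nm (x + Pi.single a 1) = ∑ x, Nm x := hs Nm (Pi.single a 1)
  have s4 : ∑ x : TorusSite 4 n, Nm (x + Pi.single a 1 + Pi.single b 1) = ∑ x, Nm x := by
    simp only [add_assoc]; exact hs Nm (Pi.single a 1 + Pi.single b 1)
  have s5 : ∑ x, Nm (x + Pi.single b 1) = ∑ x, Nm x := hs Nm (Pi.single b 1)
  rw [s1, s2, s3, s4, s5] at hsum
  linarith

/-- **Flux-region coercivity of the covariant hopping form.**  Let `S` be a set of sites of the torus of side `n` contained in
the image of the box `c + {−R..R}⁴` (`2R+1 < n`), and suppose every INTERNAL link of `S` (base `x = c + y ∈ S`, tip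
`x + μ̂ ∈ S`) is entrywise within `η` of the centre-flux pattern (`ω^{y₀}·1` in direction `1`, `ω^{y₂}·1` in direction `3`, `1` in
directions `0, 2`).  Then for every colour vector `φ` supported on `S`,
`Σ_μ Re⟨φ, F_μ φ⟩ ≤ (4 − 3/8 + 12η) Σ‖φ‖²`, `F_μ = linkHop (fundamentalRep (Fin 3)) U μ`. [folklore] -/
theorem fluxRegion_hopping_form_le {n : ℕ} [NeZero n] (U : GaugeConfig 4 n SU3) (c : Fin 4 → ℤ) (R : ℕ)
    (hR : 2 * R + 1 < n) (S : Set (TorusSite 4 n)) (η : ℝ) (hη : 0 ≤ η)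
    (hS : ∀ x ∈ S, ∃ y : Fin 4 → ℤ, y ∈ box 4 R ∧ Torus.proj n (c + y) = x)
    (hflux : ∀ y : Fin 4 → ℤ, y ∈ box 4 R → Torus.proj n (c + y) ∈ S → ∀ μ : Fin 4,
      Torus.proj n (c + y + Pi.single μ 1) ∈ S → ∀ i j : Fin 3,
        ‖(↑(U (Torus.proj n (c + y), μ)) : Matrix (Fin 3) (Fin 3) ℂ) i j -
          (if i = j then (if μ = 1 then Complex.exp (2 * Real.pi * Complex.I * ((y 0 : ℤ) : ℂ) / 3)
            else if μ = 3 then Complex.exp (2 * Real.pi * Complex.I * ((y 2 : ℤ) : ℂ) / 3) else 1) else 0)‖ ≤ η)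
    (φ : TorusSite 4 n × Fin 3 → ℂ) (hφ : ∀ p : TorusSite 4 n × Fin 3, p.1 ∉ S → φ p = 0) :
    ∑ μ : Fin 4, (star φ ⬝ᵥ linkHop (fundamentalRep (Fin 3)) U μ *ᵥ φ).re ≤ (4 - 3 / 8 + 12 * η) * ∑ p, ‖φ p‖ ^ 2 := by
  -- the two patterned planes `(0,1)` and `(2,3)`, each bounded by `fluxRegion_plane`
  have h01 := fluxRegion_plane U c R hR S η hη hS 0 1 (fun y hy h1 h2 i j => by
      have := hflux y hy h1 0 h2 i j
      rwa [if_neg (show (0 : Fin 4) ≠ 1 by decide), if_neg (show (0 : Fin 4) ≠ 3 by decide)] at this)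
    (fun y hy h1 h2 i j => by have := hflux y hy h1 1 h2 i j; rwa [if_pos rfl] at this) φ hφ
  have h23 := fluxRegion_plane U c R hR S η hη hS 2 3 (fun y hy h1 h2 i j => by
      have := hflux y hy h1 2 h2 i j
      rwa [if_neg (show (2 : Fin 4) ≠ 1 by decide), if_neg (show (2 : Fin 4) ≠ 3 by decide)] at this)
    (fun y hy h1 h2 i j => by
      have := hflux y hy h1 3 h2 i j; rwa [if_neg (show (3 : Fin 4) ≠ 1 by decide), if_pos rfl] at this) φ hφ
  simp only [fluxRegion_form_eq]
  rw [Fin.sum_univ_four]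
  linarith

end Summit.QuantumFields.QCD.Cruxes.TipPricing.ModularTemplate

end
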